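/- Lead `ym-line-cbag-p1` (prover-ym-line-cbag-p1-g7-0), route `ColdBoxAllGroups`, crux `BulkAllGroups` (stmt-QuantumFields-22255):
stubs L1b-G and N2-mean-G at a FIXED box exponent (helper, `--supports stmt-QuantumFields-22255`). -/
import Summits.QuantumFields.YangMills.Theorems.ColdBoxAllGroupsBulkAllGroupsMeanSmoothOfExpansionG
import Summits.QuantumFields.YangMills.Theorems.ColdBoxAllGroupsBulkAllGroupsStubKernelMeanExpansionG

/-!
# Stubs N2-mean-G `KernelMeanExpansionG` and L1b-G `GoodBoundaryMeanSmoothG` at a FIXED box exponent `θ` (no `∃ θ₁` packaging)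

The tree theorems `stub_kernelMeanExpansionG` (`∃ θ₂ (= 1/200)`) and `goodBoundaryMeanSmoothG_of_expansion_explicit` /
`goodBoundaryMeanSmoothG_of_kernelMeanExpansionG` (`∃ θ₁ (= θ₂)`) hide their ceilings behind an `∃`, although the proofs work at EACH
admissible `θ` with the same numerals for every compact simple `G`.  For the `G`-uniform explicit exponent record
(`Theorems/ColdBoxAllGroupsXiPowExplicit.lean`) the ceilings must stay visible; this file re-runs the same kernel-checked arguments at ONE `θ`:

* `kernelMeanExpansionG_of_le` — for every compact simple `G`, every `r : LatticeRep G` and every `0 < θ ≤ 1/200`: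
  `KernelMeanExpansionG r.ρ θ (θ/5)` (body of `stub_kernelMeanExpansionG`: `kernelMeanExpansionG_of_bounds` + `eventually_kernelDatum_boundsG`);
* `goodBoundaryMeanSmoothG_at` — for any `ρ` and ONE `θ > 0`: `KernelMeanExpansionG ρ θ (θ/5)` and `DirKernelDiagFlat` imply
  `GoodBoundaryMeanSmoothG ρ (θ/20) θ (θ/5)` (body of `goodBoundaryMeanSmoothG_of_expansion_explicit`, verbatim: telescoped interior bounds
  of the harmonic background, flat Dirichlet variance, the two expansion errors).

Only the binder structure differs from the tree versions.  No sorry; no new definition; standard axioms.  NOT a claim about the Yang–Mills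
mass gap (rung-level support, RECORD label R2xi-G); no summit statement is proved by this file.
-/

set_option autoImplicit false

noncomputable section

open MeasureTheory ProbabilityTheory Finset Real Filter Topology Metric Matrix
open Literature.Probability.LatticeModels
open Literature.MathematicalPhysics.QuantumLattice
open Literature.MathematicalPhysics.QuantumFieldTheory
open Literature.MathematicalPhysics.QuantumFieldTheory.LatticeMaxwell
open Literature.MathematicalPhysics.QuantumFieldTheory.AxialGauge
open Literature.MathematicalPhysics.QuantumFieldTheory.LatticeChain
open Literature.MathematicalPhysics.QuantumFieldTheory.LatticeForm (e d₁ d₁_swap)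
open Summit.QuantumFields.YangMills.Theorems.WeakCouplingRates
open Summit.QuantumFields.YangMills.Theorems.FreeEnergyLogCoefficient (dimE)

namespace Summit.QuantumFields.YangMills.Theorems.ColdBoxAllGroups

section KernelMean

/-- **N2-mean-G at ONE exponent**: for every compact simple `G`, every faithful unitary lattice representation `r` and every `0 < θ ≤ 1/200`,
`KernelMeanExpansionG r.ρ θ (θ/5)` — uniformly over crude-good data, deep kernel means of the plaquette cost are their Dirichlet–Gaussian
values up to `β^{−θ}`.  (Body of `stub_kernelMeanExpansionG` with the ceiling `1/200` exposed.) [folklore] -/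
theorem kernelMeanExpansionG_of_le
    (G : Type) [Group G] [TopologicalSpace G] [IsTopologicalGroup G] [CompactSpace G] [MeasurableSpace G] [BorelSpace G]
    (hG : IsCompactSimpleLieGroup G) (r : LatticeRep G) {θ : ℝ} (hθ : 0 < θ) (hθ2 : θ ≤ 1 / 200) :
    KernelMeanExpansionG r.ρ θ (θ / 5) := by
  haveI : NeZero r.N := ⟨latticeRep_N_ne_zero G hG r⟩
  refine kernelMeanExpansionG_of_bounds r.ρ r.continuous r.injective r.mem_unitary hθ (by linarith) ?_
  intro Ca CE r₂ C₂ η₀ hCa hCE hr₂ hC₂ hη₀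
  filter_upwards [eventually_kernelDatum_boundsG r.N (dimE r.ρ) hCa hCE hr₂ hC₂ hη₀ hθ hθ2] with β h
  obtain ⟨hβ1, -, hL, hm4, hmr, hmEm, hwin, hP, -, hmean⟩ := h
  have hβ0 : 0 < β := by linarith
  have hRp : Real.sqrt β * Real.sqrt (CE * (2 * (⌈β ^ θ⌉₊ : ℝ) + 3) ^ 4 * β ^ (2 * (θ / 5) - 1)) =
      Real.sqrt (β * (CE * (2 * (⌈β ^ θ⌉₊ : ℝ) + 3) ^ 4 * β ^ (2 * (θ / 5) - 1))) := (Real.sqrt_mul hβ0.le _).symm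
  rw [hRp] at hmEm hwin hmean
  -- `r ≤ m = 2·(12H²+2H+1)(√2·√(β^{2ε−1}) + 8r)`
  have hX : 0 ≤ Ca * β ^ (3 * θ + θ / 5 - 1 / 2) := by positivity
  have hS : 0 ≤ Real.sqrt 2 * Real.sqrt (β ^ (2 * (6 * θ) - 1)) := by positivity
  have hP1 : (1 : ℝ) ≤ 12 * (⌈β ^ θ⌉₊ : ℝ) ^ 2 + 2 * (⌈β ^ θ⌉₊ : ℝ) + 1 := by
    have : (0 : ℝ) ≤ (⌈β ^ θ⌉₊ : ℝ) := Nat.cast_nonneg _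
    nlinarith
  have h1 : Real.sqrt 2 * Real.sqrt (β ^ (2 * (6 * θ) - 1)) + 8 * (Ca * β ^ (3 * θ + θ / 5 - 1 / 2)) ≤
      (12 * (⌈β ^ θ⌉₊ : ℝ) ^ 2 + 2 * (⌈β ^ θ⌉₊ : ℝ) + 1) *
        (Real.sqrt 2 * Real.sqrt (β ^ (2 * (6 * θ) - 1)) + 8 * (Ca * β ^ (3 * θ + θ / 5 - 1 / 2))) :=
    le_mul_of_one_le_left (by positivity) hP1
  have hrm : Ca * β ^ (3 * θ + θ / 5 - 1 / 2) ≤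
      2 * ((12 * (⌈β ^ θ⌉₊ : ℝ) ^ 2 + 2 * (⌈β ^ θ⌉₊ : ℝ) + 1) *
        (Real.sqrt 2 * Real.sqrt (β ^ (2 * (6 * θ) - 1)) + 8 * (Ca * β ^ (3 * θ + θ / 5 - 1 / 2)))) := by linarith
  exact ⟨hβ1, hL, hm4, hmr, hmEm, hrm, hwin, hP, hmean⟩

end KernelMean

section MeanSmooth

variable {N : ℕ} {G : Type*} [Group G] [TopologicalSpace G] [IsTopologicalGroup G] [CompactSpace G]
  [MeasurableSpace G] [BorelSpace G]
variable (ρ : G →* Matrix (Fin N) (Fin N) ℂ)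

/-- **L1b-G at ONE exponent** (any `ρ`, any `θ > 0`): the one-scale kernel mean expansion `KernelMeanExpansionG ρ θ (θ/5)` and the flat
Dirichlet variance `DirKernelDiagFlat` give `GoodBoundaryMeanSmoothG ρ (θ/20) θ (θ/5)`: deep conditional means under crude-good data are
position-smooth, `|E_ω c_{p+Te₀} − E_ω c_p| ≤ K β^{2δ−1} T/H`.  (Body of `goodBoundaryMeanSmoothG_of_expansion_explicit` at a fixed `θ`.)
[folklore] -/
theorem goodBoundaryMeanSmoothG_at {θ : ℝ} (hθ : 0 < θ)
    (hexp : KernelMeanExpansionG ρ θ (θ / 5)) (hflat : DirKernelDiagFlat) :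
    GoodBoundaryMeanSmoothG ρ (θ / 20) θ (θ / 5) := by
  unfold KernelMeanExpansionG at hexp
  unfold DirKernelDiagFlat at hflat
  obtain ⟨KN, H₀, hN⟩ := hflat
  obtain ⟨C, hC0, hI⟩ := dirBackground_interior_bounds
  obtain ⟨CE, β₁, hE⟩ := hexp
  set A : ℝ := θ / 20 with hA
  set δ : ℝ := θ / 5 with hδ
  have hA0 : 0 < A := by rw [hA]; positivity
  have hAθ : 0 < θ - A := by rw [hA]; linarith
  -- thresholds: β ≥ β₁, β ≥ 1, β^θ ≥ max H₀ 8, β^{θ−A} ≥ 16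
  set N₀ : ℝ := max (H₀ : ℝ) 8 with hN₀
  refine ⟨4 + (dimE ρ : ℝ) / 2 * |KN| + 1250 * |CE| * C ^ 2,
    max (max β₁ 1) (max (N₀ ^ (1 / θ)) ((16 : ℝ) ^ (1 / (θ - A)))), fun β hβ ω hω => ?_⟩
  have hβ₁ : β₁ ≤ β := le_trans (le_trans (le_max_left _ _) (le_max_left _ _)) hβ
  have hβ1 : (1 : ℝ) ≤ β := le_trans (le_trans (le_max_right _ _) (le_max_left _ _)) hβ
  have hβ0 : 0 < β := by linarith
  have hN₀β : N₀ ≤ β ^ θ :=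
    le_rpow_of_root_le (by rw [hN₀]; positivity) hθ (le_trans (le_trans (le_max_left _ _) (le_max_right _ _)) hβ)
  have h16 : (16 : ℝ) ≤ β ^ (θ - A) :=
    le_rpow_of_root_le (by norm_num) hAθ (le_trans (le_trans (le_max_right _ _) (le_max_right _ _)) hβ)
  set H : ℕ := ⌈β ^ θ⌉₊ with hHdef
  set T : ℕ := ⌈β ^ A⌉₊ with hTdef
  obtain ⟨hT1, hT2⟩ := one_le_ceil_rpow_and_le hβ1 hA0.le
  obtain ⟨hH1, hH2⟩ := one_le_ceil_rpow_and_le hβ1 hθ.le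
  rw [← hTdef] at hT1 hT2
  rw [← hHdef] at hH1 hH2
  have hHceil : β ^ θ ≤ (H : ℝ) := Nat.le_ceil _
  have hH8 : 8 ≤ H := by
    have : (8 : ℝ) ≤ H := le_trans (le_trans (le_max_right _ _) hN₀β) hHceil
    exact_mod_cast this
  have hHH₀ : H₀ ≤ H := by
    have : (H₀ : ℝ) ≤ H := le_trans (le_trans (le_max_left _ _) hN₀β) hHceil
    exact_mod_cast this
  have hHpos : (0 : ℝ) < H := by linarith
  have hH1' : (1 : ℝ) ≤ H := hH1
  -- `8T ≤ H`
  have h8T : 8 * T ≤ H := by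
    have h1 : (8 : ℝ) * T ≤ 16 * β ^ A := by linarith
    have h2 : (16 : ℝ) * β ^ A ≤ β ^ θ := by
      have : β ^ θ = β ^ (θ - A) * β ^ A := by
        rw [← Real.rpow_add hβ0]; ring_nf
      rw [this]
      exact mul_le_mul_of_nonneg_right h16 (Real.rpow_nonneg hβ0.le _)
    have : (8 : ℝ) * T ≤ H := h1.trans (h2.trans hHceil)
    exact_mod_cast this
  -- the expansion data for this `β`, `ω`
  obtain ⟨ϑ, s, henergy, hpt⟩ := hE β hβ₁ ω hω
  -- notation
  set pin : Literature.MathematicalPhysics.QuantumLattice.ZdEdge 4 → Prop := fun e => e ∉ dirFreeEdges H with hpin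
  set Fb : Fin (dimE ρ) → Site 4 → ℝ := fun c x =>
    LatticeMaxwell.sCirc (LatticeMaxwell.glue (pin := pin) dirCorner (2 * H + 3) (ϑ c)
      (LatticeMaxwell.mean pin dirCorner (2 * H + 3) (ϑ c))) (x, 1, 2) with hFb
  set Ec : Fin (dimE ρ) → ℝ := fun c => LatticeMaxwell.formM pin dirCorner (2 * H + 3) (ϑ c) (s c) with hEc
  set xt : ℕ → Site 4 := fun t => boxCentre H + Pi.single 0 (t : ℤ) with hxt
  set Em : ℕ → ℝ := fun t => ∫ U, plaqCostAt ρ (xt t) 1 2 U ∂(boxKernelG ρ β H ω) with hEm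
  set Vt : ℕ → ℝ := fun t => boxDirProjKernel H (xt t, 1, 2) (xt t, 1, 2) with hVt
  set Bt : ℕ → ℝ := fun t => ∑ c, Fb c (xt t) ^ 2 with hBt
  have hEc0 : ∀ c, 0 ≤ Ec c := fun c => by
    rw [hEc]; simp only [LatticeMaxwell.formM]; exact Finset.sum_nonneg fun p _ => sq_nonneg _
  have hnear : ∀ t : ℕ, t ≤ T → ∀ m : Fin 4, 8 * |xt t m - (H : ℤ)| ≤ (H : ℤ) := fun t ht m => near_centre_of_le h8T ht m
  -- the expansion at the points `xt t`, `t ≤ T`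
  have hexp_t : ∀ t : ℕ, t ≤ T → |β * Em t - (dimE ρ : ℝ) / 2 * Vt t - β * Bt t| ≤ β ^ (-θ) := fun t ht => hpt (xt t) (hnear t ht)
  -- interior bounds for each colour at the points `xt t`
  have hFb_d₁ : ∀ c x, Fb c x = d₁ (fun z (i : Fin 4) =>
      LatticeMaxwell.glue (pin := pin) dirCorner (2 * H + 3) (ϑ c) (LatticeMaxwell.mean pin dirCorner (2 * H + 3) (ϑ c)) (z, i))
        x 1 2 := fun c x => by rw [hFb]; exact sCirc_eq_d₁ _ _
  have hsup : ∀ c (t : ℕ), t ≤ T → |Fb c (xt t)| ≤ C * Real.sqrt (Ec c) / (H : ℝ) ^ 2 := by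
    intro c t ht
    rw [hFb_d₁]
    exact (hI H hH8 (ϑ c) (s c) (xt t) (hnear t ht) 1 2).1
  have hgrad : ∀ c (t : ℕ), t + 1 ≤ T → |Fb c (xt (t + 1)) - Fb c (xt t)| ≤ C * Real.sqrt (Ec c) / (H : ℝ) ^ 3 := by
    intro c t ht
    have h := (hI H hH8 (ϑ c) (s c) (xt t) (hnear t (by omega)) 1 2).2 0
    have hx : xt (t + 1) = xt t + Pi.single 0 1 := by
      show boxCentre H + Pi.single 0 (((t + 1 : ℕ) : ℤ)) = boxCentre H + Pi.single 0 (t : ℤ) + Pi.single 0 1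
      rw [Nat.cast_succ, Pi.single_add, add_assoc]
    rw [hFb_d₁, hFb_d₁, hx]
    exact h
  -- per-step bound on the background term
  have hstep : ∀ t : ℕ, t + 1 ≤ T → |Bt (t + 1) - Bt t| ≤ 2 * C ^ 2 * (∑ c, Ec c) / (H : ℝ) ^ 5 := by
    intro t ht
    rw [hBt]
    simp only
    rw [← Finset.sum_sub_distrib, Finset.mul_sum, Finset.sum_div]
    refine (Finset.abs_sum_le_sum_abs _ _).trans (Finset.sum_le_sum fun c _ => ?_)
    have h1 := hsup c t (by omega)
    have h2 := hsup c (t + 1) ht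
    have h3 := hgrad c t ht
    have hs : Real.sqrt (Ec c) * Real.sqrt (Ec c) = Ec c := Real.mul_self_sqrt (hEc0 c)
    set r := Real.sqrt (Ec c) with hr
    refine (abs_sq_sub_sq_le h1 h2 h3).trans (le_of_eq ?_)
    rw [← hs]
    field_simp
  -- telescope
  have htel : |Bt T - Bt 0| ≤ (T : ℝ) * (2 * C ^ 2 * (∑ c, Ec c) / (H : ℝ) ^ 5) := by
    rw [← Finset.sum_range_sub Bt T]
    refine (Finset.abs_sum_le_sum_abs _ _).trans ?_
    calc ∑ i ∈ Finset.range T, |Bt (i + 1) - Bt i| ≤ ∑ _i ∈ Finset.range T, 2 * C ^ 2 * (∑ c, Ec c) / (H : ℝ) ^ 5 :=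
          Finset.sum_le_sum fun i hi => hstep i (by have := Finset.mem_range.1 hi; omega)
      _ = (T : ℝ) * (2 * C ^ 2 * (∑ c, Ec c) / (H : ℝ) ^ 5) := by rw [Finset.sum_const, Finset.card_range, nsmul_eq_mul]
  -- energy and geometry
  have hEsum : ∑ c, Ec c ≤ CE * (2 * (H : ℝ) + 3) ^ 4 * β ^ (2 * δ - 1) := henergy
  have hgeo : (2 * (H : ℝ) + 3) ^ 4 ≤ 625 * (H : ℝ) ^ 4 := two_mul_add_three_pow_four_le hH1'
  have hβpow : 0 < β ^ (2 * δ - 1) := Real.rpow_pos_of_pos hβ0 _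
  have hH0 : (H : ℝ) ≠ 0 := hHpos.ne'
  have hEsum' : ∑ c, Ec c ≤ |CE| * (2 * (H : ℝ) + 3) ^ 4 * β ^ (2 * δ - 1) :=
    hEsum.trans (mul_le_mul_of_nonneg_right (mul_le_mul_of_nonneg_right (le_abs_self CE) (by positivity)) hβpow.le)
  have hback : β * |Bt T - Bt 0| ≤ 1250 * |CE| * C ^ 2 * (β ^ (2 * δ) * T / H) := by
    have h2δ : β ^ (2 * δ) = β * β ^ (2 * δ - 1) := by
      rw [show 2 * δ = 1 + (2 * δ - 1) by ring, Real.rpow_add hβ0, Real.rpow_one]; ring_nf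
    rw [h2δ]
    have hT0 : (0 : ℝ) ≤ T := by positivity
    have hE' : ∑ c, Ec c ≤ |CE| * (625 * (H : ℝ) ^ 4) * β ^ (2 * δ - 1) :=
      hEsum'.trans (mul_le_mul_of_nonneg_right (mul_le_mul_of_nonneg_left hgeo (abs_nonneg CE)) hβpow.le)
    have hfrac : 2 * C ^ 2 * (∑ c, Ec c) / (H : ℝ) ^ 5 ≤ 1250 * |CE| * C ^ 2 * β ^ (2 * δ - 1) / (H : ℝ) := by
      rw [div_le_div_iff₀ (by positivity) hHpos]
      calc 2 * C ^ 2 * (∑ c, Ec c) * (H : ℝ) ≤ 2 * C ^ 2 * (|CE| * (625 * (H : ℝ) ^ 4) * β ^ (2 * δ - 1)) * (H : ℝ) := by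
            gcongr
        _ = 1250 * |CE| * C ^ 2 * β ^ (2 * δ - 1) * (H : ℝ) ^ 5 := by ring
    calc β * |Bt T - Bt 0| ≤ β * ((T : ℝ) * (2 * C ^ 2 * (∑ c, Ec c) / (H : ℝ) ^ 5)) :=
          mul_le_mul_of_nonneg_left htel hβ0.le
      _ ≤ β * ((T : ℝ) * (1250 * |CE| * C ^ 2 * β ^ (2 * δ - 1) / (H : ℝ))) := by gcongr
      _ = 1250 * |CE| * C ^ 2 * (β * β ^ (2 * δ - 1) * T / H) := by ring
  -- flatness of the Dirichlet variance
  have hflatT : |Vt T - Vt 0| ≤ KN / H := hN H hHH₀ (xt T) (xt 0) (hnear T le_rfl) (hnear 0 (Nat.zero_le _))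
  have hone : (1 : ℝ) ≤ β ^ (2 * δ) * T :=
    one_le_mul_of_one_le_of_one_le (Real.one_le_rpow hβ1 (by positivity : (0 : ℝ) ≤ 2 * δ)) hT1
  have hflat' : (dimE ρ : ℝ) / 2 * |Vt T - Vt 0| ≤ (dimE ρ : ℝ) / 2 * |KN| * (β ^ (2 * δ) * T / H) := by
    have h1 : KN / H ≤ |KN| / H := div_le_div_of_nonneg_right (le_abs_self KN) hHpos.le
    have h2 : |KN| / H ≤ |KN| * (β ^ (2 * δ) * T / H) := by
      rw [mul_div_assoc', div_le_div_iff_of_pos_right hHpos]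
      exact le_mul_of_one_le_right (abs_nonneg KN) hone
    have := hflatT.trans (h1.trans h2)
    rw [mul_assoc]
    exact mul_le_mul_of_nonneg_left this (by positivity)
  -- the two expansion errors
  have herr : 2 * β ^ (-θ) ≤ 4 * (β ^ (2 * δ) * T / H) := by
    have h1 : β ^ (-θ) * (H : ℝ) ≤ 2 := by
      calc β ^ (-θ) * (H : ℝ) ≤ β ^ (-θ) * (2 * β ^ θ) := mul_le_mul_of_nonneg_left hH2 (Real.rpow_nonneg hβ0.le _)
        _ = 2 * (β ^ (-θ) * β ^ θ) := by ring
        _ = 2 := by rw [← Real.rpow_add hβ0, neg_add_cancel, Real.rpow_zero, mul_one]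
    rw [mul_div_assoc', le_div_iff₀ hHpos]
    calc 2 * β ^ (-θ) * (H : ℝ) = 2 * (β ^ (-θ) * (H : ℝ)) := by ring
      _ ≤ 2 * 2 := by linarith
      _ ≤ 4 * (β ^ (2 * δ) * T) := by linarith
  -- assemble
  have hmain : β * |Em T - Em 0| ≤ (4 + (dimE ρ : ℝ) / 2 * |KN| + 1250 * |CE| * C ^ 2) * (β ^ (2 * δ) * T / H) := by
    have e1 := hexp_t T le_rfl
    have e0 := hexp_t 0 (Nat.zero_le _)
    have hsplit : β * (Em T - Em 0) = (β * Em T - (dimE ρ : ℝ) / 2 * Vt T - β * Bt T) - (β * Em 0 - (dimE ρ : ℝ) / 2 * Vt 0 - β * Bt 0) +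
        (dimE ρ : ℝ) / 2 * (Vt T - Vt 0) + β * (Bt T - Bt 0) := by ring
    have habs : β * |Em T - Em 0| = |β * (Em T - Em 0)| := by rw [abs_mul, abs_of_pos hβ0]
    rw [habs, hsplit]
    have hβB : |β * (Bt T - Bt 0)| = β * |Bt T - Bt 0| := by rw [abs_mul, abs_of_pos hβ0]
    have h32 : |(dimE ρ : ℝ) / 2 * (Vt T - Vt 0)| = (dimE ρ : ℝ) / 2 * |Vt T - Vt 0| := by rw [abs_mul, abs_of_nonneg (by positivity : (0 : ℝ) ≤ (dimE ρ : ℝ) / 2)]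
    calc |β * Em T - (dimE ρ : ℝ) / 2 * Vt T - β * Bt T - (β * Em 0 - (dimE ρ : ℝ) / 2 * Vt 0 - β * Bt 0) + (dimE ρ : ℝ) / 2 * (Vt T - Vt 0) + β * (Bt T - Bt 0)|
        ≤ |β * Em T - (dimE ρ : ℝ) / 2 * Vt T - β * Bt T - (β * Em 0 - (dimE ρ : ℝ) / 2 * Vt 0 - β * Bt 0) + (dimE ρ : ℝ) / 2 * (Vt T - Vt 0)| + |β * (Bt T - Bt 0)| :=
          abs_add_le _ _
      _ ≤ (|β * Em T - (dimE ρ : ℝ) / 2 * Vt T - β * Bt T - (β * Em 0 - (dimE ρ : ℝ) / 2 * Vt 0 - β * Bt 0)| + |(dimE ρ : ℝ) / 2 * (Vt T - Vt 0)|) + |β * (Bt T - Bt 0)| := by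
          gcongr; exact abs_add_le _ _
      _ ≤ ((|β * Em T - (dimE ρ : ℝ) / 2 * Vt T - β * Bt T| + |β * Em 0 - (dimE ρ : ℝ) / 2 * Vt 0 - β * Bt 0|) + |(dimE ρ : ℝ) / 2 * (Vt T - Vt 0)|) + |β * (Bt T - Bt 0)| := by
          gcongr; exact abs_sub _ _
      _ ≤ ((β ^ (-θ) + β ^ (-θ)) + (dimE ρ : ℝ) / 2 * |KN| * (β ^ (2 * δ) * T / H)) + 1250 * |CE| * C ^ 2 * (β ^ (2 * δ) * T / H) := by
          rw [hβB, h32]; gcongr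
      _ ≤ (4 + (dimE ρ : ℝ) / 2 * |KN| + 1250 * |CE| * C ^ 2) * (β ^ (2 * δ) * T / H) := by linarith [herr, hflat', hback]
  -- conclude: divide by β
  have hgoal : |Em T - Em 0| ≤ (4 + (dimE ρ : ℝ) / 2 * |KN| + 1250 * |CE| * C ^ 2) * β ^ (2 * δ - 1) * (T : ℝ) / (H : ℝ) := by
    have h2δ : β ^ (2 * δ) = β * β ^ (2 * δ - 1) := by
      rw [show 2 * δ = 1 + (2 * δ - 1) by ring, Real.rpow_add hβ0, Real.rpow_one]; ring_nf
    rw [h2δ] at hmain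
    have : β * |Em T - Em 0| ≤ β * ((4 + (dimE ρ : ℝ) / 2 * |KN| + 1250 * |CE| * C ^ 2) * β ^ (2 * δ - 1) * (T : ℝ) / (H : ℝ)) := by
      calc β * |Em T - Em 0| ≤ _ := hmain
        _ = β * ((4 + (dimE ρ : ℝ) / 2 * |KN| + 1250 * |CE| * C ^ 2) * β ^ (2 * δ - 1) * (T : ℝ) / (H : ℝ)) := by ring
    exact le_of_mul_le_mul_left this hβ0
  -- match the statement of `GoodBoundaryMeanSmooth`
  have hx0 : xt 0 = boxCentre H := by rw [hxt]; simp
  have hEm0 : Em 0 = ∫ U, plaqCostAt ρ (boxCentre H) 1 2 U ∂(boxKernelG ρ β H ω) := by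
    rw [hEm]; simp only [hx0]
  have hEmT : Em T = ∫ U, plaqCostAt ρ (boxCentre H + Pi.single 0 (T : ℤ)) 1 2 U ∂(boxKernelG ρ β H ω) := by
    rw [hEm]
  rw [hEm0, hEmT] at hgoal
  simpa only [hHdef, hTdef, hδ, hA] using hgoal

end MeanSmooth

end Summit.QuantumFields.YangMills.Theorems.ColdBoxAllGroups

end
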